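import Mathlib
import Summits.Schanuel.Schanuel.Theses.LogPatterns

/-!
# Birth skeleton for the piece `LogSector` (item stmt-Schanuel-4310) of the split of `RankLeTrdeg`

Seat `planner-cstrat-stmt-Schanuel-3486-r1-0` (crux-strategist, BC2 redirect of
`ExpMordellWeil.RankLeTrdeg` into `LogSector ∧ OffLogSector`; BC3 "skeleton per piece").
`LogSector` = algebraic independence of `ℚ`-linearly independent logarithms of algebraic numbers
(= `Literature.Barriers.Schanuel.AlgIndepLogarithms`), concluded BY NAME as
`Summit.Schanuel.Schanuel.Theses.LogPatterns.LogSector` (the shared decl of item 4310; the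
`ExpMordellWeil.LogSector` child written by `route edit --split` has the identical statement).

LINE (determinantal transfer, Roy 1995 / Waldschmidt 2005 Conj. 1.11 for rational pencils):
* `stub_detUniversality` — universality of the determinant (Valiant 1979; folklore): every
  `P ∈ ℚ[X₁,…,Xₙ]` is `det (A₀ + Σₖ Xₖ Aₖ)` for square rational matrices `A₀, Aₖ`. Provable now
  (combinatorial construction), size M.
* `stub_affineRankRigidity` — AFFINE RANK RIGIDITY AT LOGARITHMIC POINTS: a pencil of rational
  matrices `A₀ + Σₖ xₖ Aₖ` that is singular at a point `l ∈ 𝓛ⁿ` with `ℚ`-linearly independent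
  coordinates is identically singular. This is the crux in the format of the six exponentials /
  linear subgroup theorems (rank of matrices whose entries are linear forms in logarithms), where
  the tree PROVES Roy's half `structuralRank M ≤ 2 · rank M`
  (`Literature.Barriers.Schanuel.roy1995_structuralRank_le_two_mul_rank_holds`) and records the
  strong six exponentials theorem; equivalent to `LogSector` modulo `stub_detUniversality`
  (TRANSFER, Waldschmidt2005 Conj. 1.11 ⟺ Conj. 1.1 "as noted by D. Roy", GL326 Prop. 12.13), the
  gain being the linear-algebraic format (rank vs. `ℚ`-structure) in which every existing partial
  result is stated. Hard stub.
* `LogSector_of` — real proof: a relation `P(l) = 0` becomes a singular rational pencil at `l`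
  (stub 1), hence an identically vanishing determinant (stub 2), hence `P = 0` on `ℂⁿ`, hence
  `P = 0` (`MvPolynomial.funext` over `ℂ` + injectivity of `map (algebraMap ℚ ℂ)`).
-/

noncomputable section

set_option linter.dupNamespace false

namespace Summit.Schanuel.Schanuel.Cruxes.RankLeTrdeg.LogSectorBirth

open Summit.Schanuel.Schanuel.Theses.LogPatterns (LogSector)

/-- STUB 1 (provable now, M): universality of the determinant over `ℚ` — every polynomial in
`n` variables with rational coefficients is the determinant of a square pencil `A₀ + Σₖ Xₖ Aₖ` of
rational matrices (as functions on `ℂⁿ`). [Valiant 1979, "Completeness classes in algebra",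
Thm. 1; folklore] -/
theorem stub_detUniversality :
    ∀ (n : ℕ) (P : MvPolynomial (Fin n) ℚ), ∃ (d : ℕ) (A₀ : Matrix (Fin d) (Fin d) ℚ)
      (A : Fin n → Matrix (Fin d) (Fin d) ℚ), ∀ x : Fin n → ℂ,
        MvPolynomial.aeval x P =
          (A₀.map (algebraMap ℚ ℂ) + ∑ k, x k • (A k).map (algebraMap ℚ ℂ)).det := by
  sorry

/-- STUB 2 (hard; TRANSFER of the piece): affine rank rigidity of rational pencils at points of
`𝓛ⁿ` with `ℚ`-linearly independent coordinates — singular at `l` ⇒ identically singular.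
[Waldschmidt2005, §1 Conj. 1.11 (rank = structural rank on `L̃`) restricted to rational pencils;
Roy1995, §1 Remark (i) and §2 (reduction of Conj. 1.1 to determinantal varieties)] -/
theorem stub_affineRankRigidity :
    ∀ (n d : ℕ) (A₀ : Matrix (Fin d) (Fin d) ℚ) (A : Fin n → Matrix (Fin d) (Fin d) ℚ)
      (l : Fin n → ℂ), (∀ i, IsAlgebraic ℚ (Complex.exp (l i))) → LinearIndependent ℚ l →
        (A₀.map (algebraMap ℚ ℂ) + ∑ k, l k • (A k).map (algebraMap ℚ ℂ)).det = 0 →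
          ∀ x : Fin n → ℂ,
            (A₀.map (algebraMap ℚ ℂ) + ∑ k, x k • (A k).map (algebraMap ℚ ℂ)).det = 0 := by
  sorry

/-! ### Stub statements by name -/

namespace Statement

/-- Statement of `stub_detUniversality`. -/
abbrev stub_detUniversality : Prop := type_of% @LogSectorBirth.stub_detUniversality
/-- Statement of `stub_affineRankRigidity`. -/
abbrev stub_affineRankRigidity : Prop := type_of% @LogSectorBirth.stub_affineRankRigidity

end Statement

/-- COMPOSITION (kernel-checked, no sorry; stub statements BY NAME via the `type_of%` abbrevs): a
relation `P(l) = 0` is a singular rational pencil at `l` (stub 1), hence an identically singular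
pencil (stub 2), hence `P` vanishes on `ℂⁿ`, hence `P = 0` (`MvPolynomial.funext` over `ℂ` and
injectivity of `MvPolynomial.map (algebraMap ℚ ℂ)`). -/
theorem LogSector_of (h₁ : Statement.stub_detUniversality)
    (h₂ : Statement.stub_affineRankRigidity) : LogSector := by
  intro n l halg hli
  rw [algebraicIndependent_iff]
  intro P hP
  obtain ⟨d, A₀, A, hA⟩ := h₁ n P
  have hdet : (A₀.map (algebraMap ℚ ℂ) + ∑ k, l k • (A k).map (algebraMap ℚ ℂ)).det = 0 := by
    rw [← hA l]; exact hP
  have hall : ∀ x : Fin n → ℂ, MvPolynomial.aeval x P = 0 := fun x => by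
    rw [hA x]; exact h₂ n d A₀ A l halg hli hdet x
  have hmap : MvPolynomial.map (algebraMap ℚ ℂ) P = 0 := by
    apply MvPolynomial.funext
    intro x
    rw [MvPolynomial.eval_map, ← MvPolynomial.aeval_def, hall x, map_zero]
  exact MvPolynomial.map_injective (algebraMap ℚ ℂ) (algebraMap ℚ ℂ).injective
    (hmap.trans (map_zero _).symm)

/-- The piece along this line MODULO exactly the two registered stubs (depends on `sorryAx` only
through `stub_*`). -/
theorem LogSector_proof : LogSector :=
  LogSector_of stub_detUniversality stub_affineRankRigidity

end Summit.Schanuel.Schanuel.Cruxes.RankLeTrdeg.LogSectorBirth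

end
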